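import Summits.MatrixMultiplication.MatrixMultiplication.Theorems.GradedDesignFamily.Negative.SL2MinDegree

/-!
# The det-spread law: a TPP triple of `GL₂(K)` pays the sliced-horn cap once per pair of determinant classes
# (negative-side support for `stub_subfieldCell`, crux `GradedDesignFamily`, stmt-MatrixMultiplication-7610;
# line `quadratic-extension-level-one-cell`, lead c4, instance B)

The closer S3 of the line asks for level-one separated triples `(X, Y, Z)` in `GL₂(K)`, `K` a finite
field, with `X = φ(SL₂ k)` of determinant `1` and `|Y|, |Z| ≥ c·|K|^{3/2}`.  The tree's SLICED-HORN
bound `slicedHorn_card_mul_le_uncond` (`Negative/SL2MinDegree.lean`) caps every triple with the triple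
product property whose `X` has determinant `1` and whose `Y` and `Z` each sit in ONE determinant class:
`|X||Y||Z| ≤ cap K := √2·|SL₂ K|^{3/2}/√(|K|−1) + |SL₂ K|` (`≈ √2·|K|⁴`).

This file removes the slicing hypothesis at the price of the number of determinant classes met:

* `detSpread_card_mul_le` — for EVERY triple `(X, Y, Z)` with the triple product property in `GL₂(K)`
  and `det = 1` on `X`,
  `|X||Y||Z| ≤ #det(Y) · #det(Z) · cap K`,
  where `#det(Y) = |det '' Y|` is the number of determinant classes that `Y` meets.

PROOF.  Partition `Y = ⊔_{a ∈ det Y} Y_a`, `Y_a := {y ∈ Y : det y = a}`, and `Z = ⊔_b Z_b` likewise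
(`Finset.card_eq_sum_card_image`).  Each sub-triple `(X, Y_a, Z_b)` again has the triple product
property (`TripleProductProperty.mono`) and is sliced, so `|X||Y_a||Z_b| ≤ cap K`; summing over the
`#det(Y)·#det(Z)` pairs `(a, b)` gives the claim.  Consequently an S3 witness (which needs
`|X||Y||Z| ≳ c²·|K|^{9/2}`) must meet `≳ c²·√|K|/√2` pairs of determinant classes: S3 designs are
forced to SPREAD over the determinant classes `K^×`, quantitatively.

Sorry-free; axioms `propext`, `Classical.choice`, `Quot.sound`.
-/

set_option linter.dupNamespace false

noncomputable section

open scoped BigOperators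
open Literature.Combinatorics.Additive

namespace Summit.MatrixMultiplication.MatrixMultiplication.Theorems.GradedDesignFamily.Negative

/-- **The det-spread law.**  For every finite field `K` and every triple `(X, Y, Z)` with the triple
product property in `GL₂(K)` such that `det = 1` on `X`:
`|X||Y||Z| ≤ #det(Y) · #det(Z) · (√2·|SL₂ K|^{3/2}/√(|K|−1) + |SL₂ K|)`, where `#det(Y)` (`#det(Z)`) is
the number of values of `det` on `Y` (on `Z`).  (Partition `Y` and `Z` into determinant classes, apply
the sliced-horn bound `slicedHorn_card_mul_le_uncond` to each of the `#det(Y)·#det(Z)` sliced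
sub-triples — sub-triples of a TPP triple are TPP — and sum.) -/
theorem detSpread_card_mul_le {K : Type} [Field K] [Fintype K] [DecidableEq K]
    (X Y Z : Finset (Matrix.GeneralLinearGroup (Fin 2) K))
    (hT : Literature.Combinatorics.Additive.TripleProductProperty X Y Z)
    (hX : ∀ x ∈ X, Matrix.GeneralLinearGroup.det x = 1) :
    ((X.card * Y.card * Z.card : ℕ) : ℝ) ≤
      ((Y.image Matrix.GeneralLinearGroup.det).card *
          (Z.image Matrix.GeneralLinearGroup.det).card : ℕ) *
        (Real.sqrt 2 * (Fintype.card (Matrix.SpecialLinearGroup (Fin 2) K) : ℝ) ^ (3 / 2 : ℝ) /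
            Real.sqrt ((Fintype.card K : ℝ) - 1) +
          Fintype.card (Matrix.SpecialLinearGroup (Fin 2) K)) := by
  classical
  -- the determinant classes of `Y` and of `Z`
  set Yc : Kˣ → Finset (Matrix.GeneralLinearGroup (Fin 2) K) :=
    fun a => Y.filter (fun y => Matrix.GeneralLinearGroup.det y = a) with hYc
  set Zc : Kˣ → Finset (Matrix.GeneralLinearGroup (Fin 2) K) :=
    fun b => Z.filter (fun z => Matrix.GeneralLinearGroup.det z = b) with hZc
  have hYsum : Y.card = ∑ a ∈ Y.image Matrix.GeneralLinearGroup.det, (Yc a).card :=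
    Finset.card_eq_sum_card_image _ _
  have hZsum : Z.card = ∑ b ∈ Z.image Matrix.GeneralLinearGroup.det, (Zc b).card :=
    Finset.card_eq_sum_card_image _ _
  -- each sliced sub-triple is capped by the sliced-horn bound
  have hslice : ∀ a b : Kˣ, ((X.card * (Yc a).card * (Zc b).card : ℕ) : ℝ) ≤
      Real.sqrt 2 * (Fintype.card (Matrix.SpecialLinearGroup (Fin 2) K) : ℝ) ^ (3 / 2 : ℝ) /
          Real.sqrt ((Fintype.card K : ℝ) - 1) +
        Fintype.card (Matrix.SpecialLinearGroup (Fin 2) K) := by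
    intro a b
    refine slicedHorn_card_mul_le_uncond X (Yc a) (Zc b)
      (hT.mono subset_rfl (Finset.filter_subset _ _) (Finset.filter_subset _ _)) hX ?_ ?_
    · intro y hy y' hy'
      rw [hYc, Finset.mem_filter] at hy hy'
      rw [hy.2, hy'.2]
    · intro z hz z' hz'
      rw [hZc, Finset.mem_filter] at hz hz'
      rw [hz.2, hz'.2]
  -- sum over the pairs of classes
  calc ((X.card * Y.card * Z.card : ℕ) : ℝ)
      = ∑ a ∈ Y.image Matrix.GeneralLinearGroup.det, ∑ b ∈ Z.image Matrix.GeneralLinearGroup.det,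
          ((X.card * (Yc a).card * (Zc b).card : ℕ) : ℝ) := by
        rw [hYsum, hZsum]
        push_cast
        rw [mul_assoc, Finset.sum_mul_sum, Finset.mul_sum]
        refine Finset.sum_congr rfl fun a _ => ?_
        rw [Finset.mul_sum]
        refine Finset.sum_congr rfl fun b _ => ?_
        ring
    _ ≤ ∑ a ∈ Y.image Matrix.GeneralLinearGroup.det, ∑ b ∈ Z.image Matrix.GeneralLinearGroup.det,
          (Real.sqrt 2 * (Fintype.card (Matrix.SpecialLinearGroup (Fin 2) K) : ℝ) ^ (3 / 2 : ℝ) /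
              Real.sqrt ((Fintype.card K : ℝ) - 1) +
            Fintype.card (Matrix.SpecialLinearGroup (Fin 2) K)) :=
        Finset.sum_le_sum fun a _ => Finset.sum_le_sum fun b _ => hslice a b
    _ = ((Y.image Matrix.GeneralLinearGroup.det).card *
          (Z.image Matrix.GeneralLinearGroup.det).card : ℕ) *
        (Real.sqrt 2 * (Fintype.card (Matrix.SpecialLinearGroup (Fin 2) K) : ℝ) ^ (3 / 2 : ℝ) /
            Real.sqrt ((Fintype.card K : ℝ) - 1) +
          Fintype.card (Matrix.SpecialLinearGroup (Fin 2) K)) := by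
        rw [Finset.sum_const, Finset.sum_const, smul_smul, nsmul_eq_mul, Nat.cast_mul]
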